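import Literature.NumberTheory.Weil1964.ArchMetaplecticStrongTopology
import Literature.NumberTheory.Weil1964.ArchMetaplecticSplittingsHolds
import Literature.NumberTheory.Weil1964.ArchMetaplecticReindex
import HarnessLib

/-!
# Schur's remark in the strong operator topology: continuity transfers between sections of `Mp^𝓢(W) → Sp(W)`
# along the vacuum coefficient; relabelling is a homeomorphism (kernel, 0 named facts)

Topic `NumberTheory/Weil1964`; namespace `Literature.NumberTheory.Weil1964.MpS`.  KERNEL ONLY: theorems; no
definition, no record, no hypothesis, no `sorry`.  Continuation of `ArchMetaplecticStrongTopology` (the strong operator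
topology on `Mp^𝓢(W) = MpS σ`: `MpS.continuous_iff`, `MpS.continuousAt_iff`, `MpS.continuous_vac`), of
`ArchMetaplecticExtension` / `ArchMetaplecticNormality` (Schur: two elements over the same `g ∈ Sp(W)` differ by a unit
scalar, `exists_unitSmul_of_proj_eq`; `vac_eq_mul_of_smul`), of `ArchMetaplecticSplittingsHolds` (`vac_ne_zero`: EVERY
element of `Mp^𝓢(W)` has a non-zero vacuum coefficient `C(x) = ⟪k₀, x k₀⟫`, Folland's Theorem (4.37) proved) and of
`ArchMetaplecticReindex` (the relabelling isomorphisms `MpS.reindex E`).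

THE POINT.  A section `F : X → Mp^𝓢(W)` of the projection over some map `X → Sp(W)` is in general not continuous
(e.g. a principal-branch square-root normalisation jumps across its cut), and its continuity at a point cannot be read
off the symplectic projection alone (the two sheets `x`, `−x` are separated, `MpS.disjoint_nhds_negOne_mul`).  Schur's
remark [Folland1989, §4.2 p. 156: an operator intertwining `ρ(w)` with `ρ(gw)` is unique up to a phase] pins the
freedom to ONE complex number per point, and the vacuum coefficient reads it:

* §1 **the Schur scalar is `C(y)/C(x)`**: if `proj x = proj y` then `y f = (C(y)/C(x)) · x f` for every Schwartz `f`
  (`apply_eq_vac_div_vac_smul`), the scalar being unimodular (`norm_vac_div_vac`);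
* §2 **continuity transfers along the vacuum coefficient**: if `F, Y : X → Mp^𝓢(W)` have the same projections,
  `Y` is continuous at `t₀` (strong operator topology) and the scalar function `t ↦ C(F t)` is continuous at `t₀`,
  then `F` is continuous at `t₀` (`continuousAt_of_proj_eq`); `ContinuousOn` / `Continuous` forms
  (`continuousOn_of_proj_eq`, `continuous_of_proj_eq`), and the converse reading `continuousAt_iff_of_proj_eq`
  (given a continuous comparison section, continuity of `F` at `t₀` IS continuity of `C ∘ F` at `t₀`);
* §3 **relabelling is strongly continuous**: `MpS.reindex E : Mp^𝓢(ℝ^{σ′²}) →* Mp^𝓢(ℝ^{σ²})` is continuous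
  (`continuous_reindex`), indeed a homeomorphism (`continuousAt_reindex_comp_iff`, `continuous_reindex_comp_iff`), and so
  is `Mp₂.reindex E`
  (`Mp₂.continuous_reindex`, subspace topologies).

Use (pub-hodgecm2 row B08-2, general real rank): the principal `det^{1/2}` sections of
`Paul1998.DetCoverPrincipalSection` are compared with the strongly continuous `det^{1/2}`-normalised HOMOMORPHISM
`UnitaryWeil.weilHomV` of `ArchMetaplecticUnitarySplitting(Continuity)`; §2 turns the continuity of the latter into
continuity of the former wherever `√det` is continuous, and §3 carries the first factor of a dual pair to the second.

## References

* [Folland1989] G. B. Folland, *Harmonic Analysis in Phase Space*, Annals of Math. Studies 122, Princeton UP 1989,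
  §4.2 (4.23), the Schur remark p. 156 L18–30, (4.36), Thm. (4.37).
* [Weil1964] A. Weil, *Sur certains groupes d'opérateurs unitaires*, Acta Math. 111 (1964), Chap. I n° 12 p. 160
  (independence of the coordinates).
-/

set_option autoImplicit false

noncomputable section

open MeasureTheory Complex SchwartzMap Filter
open scoped InnerProductSpace ComplexConjugate Topology

namespace Literature.NumberTheory.Weil1964

open Literature.Analysis.SegalBargmann Literature.RepresentationTheory.HeisenbergGroup

variable {σ : Type*} [Fintype σ] [DecidableEq σ]

namespace MpS

/-! ## 1. The Schur scalar between two elements over the same symplectic map is `C(y)/C(x)` -/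

/-- **Schur's scalar read at the vacuum**: if `x, y ∈ Mp^𝓢(W)` lie over the same `g ∈ Sp(W)` then
`y f = (C(y)/C(x)) · x f` for every `f ∈ 𝓢(ℝ^σ)`. [cite: Folland1989, §4.2 p. 156 L18–30, (4.36)] -/
theorem apply_eq_vac_div_vac_smul {x y : MpS σ} (h : proj x = proj y) (f : SchwartzMap (σ → ℝ) ℂ) :
    y.1.2 f = (vac y / vac x) • x.1.2 f := by
  obtain ⟨c, -, hcf⟩ := exists_unitSmul_of_proj_eq h
  have hv : vac y = c * vac x := vac_eq_mul_of_smul hcf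
  rw [hcf f, hv, mul_div_assoc, div_self (vac_ne_zero x), mul_one]

/-- The Schur scalar `C(y)/C(x)` is unimodular. [cite: Folland1989, §4.2 p. 156 L18–30] -/
theorem norm_vac_div_vac {x y : MpS σ} (h : proj x = proj y) : ‖vac y / vac x‖ = 1 := by
  obtain ⟨c, hc, hcf⟩ := exists_unitSmul_of_proj_eq h
  have hv : vac y = c * vac x := vac_eq_mul_of_smul hcf
  rw [hv, mul_div_assoc, div_self (vac_ne_zero x), mul_one, hc]

/-- … and non-zero. [cite: Folland1989, §4.2 p. 156 L18–30] -/
theorem vac_div_vac_ne_zero {x y : MpS σ} (h : proj x = proj y) : vac y / vac x ≠ 0 := fun h0 => by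
  have h1 := norm_vac_div_vac h
  rw [h0, norm_zero] at h1
  exact zero_ne_one h1

/-- The matrix coefficients in `L²`: `y f = (C(y)/C(x)) · x f` read in `L²(ℝ^σ)`. [cite: Folland1989, §4.2 p. 156 L24] -/
theorem toL2_apply_eq_vac_div_vac_smul {x y : MpS σ} (h : proj x = proj y) (f : SchwartzMap (σ → ℝ) ℂ) :
    toL2 (y.1.2 f) = (vac y / vac x) • toL2 (x.1.2 f) := by
  rw [apply_eq_vac_div_vac_smul h f, map_smul]

/-! ## 2. Continuity transfers along the vacuum coefficient -/

section Transfer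

variable {X : Type*} [TopologicalSpace X] {F Y : X → MpS σ}

/-- **Continuity at a point transfers between sections with the same projections**: if `proj (F t) = proj (Y t)`
for all `t`, `Y` is continuous at `t₀` in the strong operator topology and `t ↦ C(F t)` is continuous at `t₀`, then
`F` is continuous at `t₀`. [cite: Folland1989, §4.2 p. 156 L18–30, (4.36)] -/
theorem continuousAt_of_proj_eq (h : ∀ t, proj (F t) = proj (Y t)) {t₀ : X} (hY : ContinuousAt Y t₀)
    (hF : ContinuousAt (fun t => vac (F t)) t₀) : ContinuousAt F t₀ := by
  rw [continuousAt_iff]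
  intro f
  have e : (fun t => toL2 ((F t).1.2 f)) = fun t => (vac (F t) / vac (Y t)) • toL2 ((Y t).1.2 f) :=
    funext fun t => toL2_apply_eq_vac_div_vac_smul ((h t).symm) f
  rw [e]
  have hYv : ContinuousAt (fun t => vac (Y t)) t₀ := continuous_vac.continuousAt.comp hY
  exact (hF.div hYv (vac_ne_zero (Y t₀))).smul (continuousAt_iff.1 hY f)

/-- **… and conversely**: next to a comparison section continuous at `t₀`, `F` is continuous at `t₀` IFF its vacuum
coefficient is. [cite: Folland1989, §4.2 p. 156 L18–30, (4.36)] -/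
theorem continuousAt_iff_of_proj_eq (h : ∀ t, proj (F t) = proj (Y t)) {t₀ : X} (hY : ContinuousAt Y t₀) :
    ContinuousAt F t₀ ↔ ContinuousAt (fun t => vac (F t)) t₀ :=
  ⟨fun hF => continuous_vac.continuousAt.comp hF, continuousAt_of_proj_eq h hY⟩

/-- `ContinuousWithinAt` form of the transfer. [cite: Folland1989, §4.2 p. 156 L18–30, (4.36)] -/
theorem continuousWithinAt_of_proj_eq (h : ∀ t, proj (F t) = proj (Y t)) {s : Set X} {t₀ : X}
    (hY : ContinuousWithinAt Y s t₀) (hF : ContinuousWithinAt (fun t => vac (F t)) s t₀) :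
    ContinuousWithinAt F s t₀ := by
  rw [ContinuousWithinAt, isInducing_orbitL2.nhds_eq_comap, Filter.tendsto_comap_iff, tendsto_pi_nhds]
  intro f
  have e : (orbitL2 ∘ F) = fun t f => (vac (F t) / vac (Y t)) • toL2 ((Y t).1.2 f) :=
    funext fun t => funext fun f => toL2_apply_eq_vac_div_vac_smul ((h t).symm) f
  rw [e]
  have hYv : ContinuousWithinAt (fun t => vac (Y t)) s t₀ := continuous_vac.continuousAt.comp_continuousWithinAt hY
  have hYf : ContinuousWithinAt (fun t => toL2 ((Y t).1.2 f)) s t₀ :=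
    (continuous_apply_toL2 f).continuousAt.comp_continuousWithinAt hY
  have h3 := (hF.div hYv (vac_ne_zero (Y t₀))).smul hYf
  have e0 : orbitL2 (F t₀) f = (vac (F t₀) / vac (Y t₀)) • toL2 ((Y t₀).1.2 f) :=
    toL2_apply_eq_vac_div_vac_smul ((h t₀).symm) f
  rw [e0]
  exact h3

/-- `ContinuousOn` form of the transfer. [cite: Folland1989, §4.2 p. 156 L18–30, (4.36)] -/
theorem continuousOn_of_proj_eq (h : ∀ t, proj (F t) = proj (Y t)) {s : Set X} (hY : ContinuousOn Y s)
    (hF : ContinuousOn (fun t => vac (F t)) s) : ContinuousOn F s := fun t ht =>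
  continuousWithinAt_of_proj_eq h (hY t ht) (hF t ht)

/-- **Global form**: a section with the projections of a continuous section and a continuous vacuum coefficient is
continuous. [cite: Folland1989, §4.2 p. 156 L18–30, (4.36)] -/
theorem continuous_of_proj_eq (h : ∀ t, proj (F t) = proj (Y t)) (hY : Continuous Y)
    (hF : Continuous fun t => vac (F t)) : Continuous F :=
  continuous_iff_continuousAt.2 fun _ => continuousAt_of_proj_eq h hY.continuousAt hF.continuousAt

/-- … and conversely its vacuum coefficient is then continuous: the two are EQUIVALENT next to a continuous
comparison section. [cite: Folland1989, §4.2 p. 156 L18–30, (4.36)] -/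
theorem continuous_iff_of_proj_eq (h : ∀ t, proj (F t) = proj (Y t)) (hY : Continuous Y) :
    Continuous F ↔ Continuous fun t => vac (F t) :=
  ⟨fun hF => continuous_vac.comp hF, continuous_of_proj_eq h hY⟩

/-- **The Schur scalar of two continuous sections is continuous** (a continuous unimodular function).
[cite: Folland1989, §4.2 p. 156 L18–30] -/
theorem continuous_vac_div_vac (hF : Continuous F) (hY : Continuous Y) :
    Continuous fun t => vac (F t) / vac (Y t) :=
  (continuous_vac.comp hF).div (continuous_vac.comp hY) fun t => vac_ne_zero (Y t)

end Transfer

/-! ## 3. Relabelling of the coordinates is a homeomorphism of `Mp^𝓢` -/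

section Reindex

variable {σ' : Type*} [Fintype σ'] [DecidableEq σ']

omit [DecidableEq σ] [DecidableEq σ'] in
/-- matrix coefficients of a relabelled element, read in `L²`: `(reindex E x) f = e_* (x (e_*⁻¹ f))`.
[cite: Folland1989, §1.3 (1.25)] -/
theorem toL2_reindex_apply (E : σ ≃ σ') (x : MpS σ') (f : SchwartzMap (σ → ℝ) ℂ) :
    toL2 ((reindex E x).1.2 f) = l2Reindex E (toL2 (x.1.2 ((schwartzTransport (reindexCLE E)).symm f))) := by
  rw [reindex_apply, toL2_schwartzTransport_reindexCLE]

omit [DecidableEq σ] [DecidableEq σ'] in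
/-- **`MpS.reindex E` is continuous** for the strong operator topologies. [cite: Weil1964, Chap. I n° 12 p. 160] -/
theorem continuous_reindex (E : σ ≃ σ') : Continuous (reindex E : MpS σ' → MpS σ) := by
  rw [continuous_iff]
  intro f
  simp only [toL2_reindex_apply]
  exact (l2Reindex E).continuous.comp (continuous_apply_toL2 _)

omit [DecidableEq σ] [DecidableEq σ'] in
/-- `reindex E.symm (reindex E x) = x`. [cite: Weil1964, Chap. I n° 12 p. 160] -/
theorem reindex_symm_apply_reindex (E : σ ≃ σ') (x : MpS σ') : reindex E.symm (reindex E x) = x :=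
  (reindexMulEquiv E).symm_apply_apply x

omit [DecidableEq σ] [DecidableEq σ'] in
/-- `reindex E (reindex E.symm y) = y`. [cite: Weil1964, Chap. I n° 12 p. 160] -/
theorem reindex_apply_reindex_symm (E : σ ≃ σ') (y : MpS σ) : reindex E (reindex E.symm y) = y :=
  (reindexMulEquiv E).apply_symm_apply y

omit [DecidableEq σ] [DecidableEq σ'] in
/-- **Relabelling is a homeomorphism**: a map into `Mp^𝓢(ℝ^{σ′²})` is continuous at a point iff its relabelling along
`E` is (the inverse relabelling is along `E⁻¹`). [cite: Weil1964, Chap. I n° 12 p. 160] -/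
theorem continuousAt_reindex_comp_iff (E : σ ≃ σ') {X : Type*} [TopologicalSpace X] {F : X → MpS σ'} {t₀ : X} :
    ContinuousAt (fun t => reindex E (F t)) t₀ ↔ ContinuousAt F t₀ := by
  refine ⟨fun h => ?_, fun h => (continuous_reindex E).continuousAt.comp h⟩
  have h' := (continuous_reindex E.symm).continuousAt.comp h
  simpa only [Function.comp_def, reindex_symm_apply_reindex] using h'

omit [DecidableEq σ] [DecidableEq σ'] in
/-- … and the same for global continuity. [cite: Weil1964, Chap. I n° 12 p. 160] -/
theorem continuous_reindex_comp_iff (E : σ ≃ σ') {X : Type*} [TopologicalSpace X] {F : X → MpS σ'} :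
    (Continuous fun t => reindex E (F t)) ↔ Continuous F := by
  simp only [continuous_iff_continuousAt, continuousAt_reindex_comp_iff]

/-- **`Mp₂.reindex E` is continuous** (subspace topologies). [cite: Weil1964, Chap. I n° 12 p. 160; Folland1989, §4.2 Thm. (4.37)] -/
theorem Mp₂.continuous_reindex (E : σ ≃ σ') :
    Continuous (Mp₂.reindex E : Mp₂ σ' → Mp₂ σ) :=
  continuous_induced_rng.2
    (show Continuous fun x : Mp₂ σ' => MpS.reindex E (x : MpS σ') from
      (MpS.continuous_reindex E).comp continuous_subtype_val)

end Reindex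

end MpS

end Literature.NumberTheory.Weil1964
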